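import Summits.BirchSwinnertonDyer.BirchSwinnertonDyer.Theorems.GenusKolyvaginAtTwoGenusPrimitiveSupplyAtTwoDoorSupplyAll
import Summits.BirchSwinnertonDyer.BirchSwinnertonDyer.Theorems.ByReductionTypeAtTwoRankOneAtTwoBigImageOddLocalOneDoorGlue
import HarnessLib

/-!
# Route `GenusKolyvaginAtTwo`, crux #2 `GenusPrimitiveSupplyAtTwo` (stmt-BirchSwinnertonDyer-22136) — consumer side:
# THE fkl ONE-DOOR ASSEMBLY OF CRUX `RankOneAtTwoBigImageOddLocal` (stmt-23715) WITH THE DOOR SUPPLY DISCHARGED —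
# FOUR inputs (`S_pub`, `DoorIndexLawAtTwo`, `DoorTwistValueAtTwo`, `S_manin`) instead of five

Width seat `bsd-line-gk2-p4` g15 (cell `bsd-f1-sign2`). THEOREMS ONLY (no definition, no named fact, no `sorry`); helper
`--supports stmt-BirchSwinnertonDyer-22136`; no item is closed; BSD is not proved by any of this.

WHY. The fkl line's `RankOneAtTwoOneDoor.stub_doorGlue : S_doorGlue` / `rankOneAtTwoBigImageOddLocal_of_oneDoor` derive the slice `S_sliceMW` and
the crux `RankOneAtTwoBigImageOddLocal` BY NAME from FIVE displayed inputs, one of which is the `L`-free door supply `DoorSupplyAtTwo` (AN-27 supply,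
«THEOREM on paper»). This lineage proved the supply for every rank-one `W` with `E(ℚ)[2] = 0` and `Ш(W)` finite
(`GenusKolyTransp.exists_doorAdmissible_twistSelmerTwoCard_eq_one_of_rank_one_of_shaFinite`, file `…DoorSupplyAll`), and INSIDE the glue `Ш(W)` IS
finite: `S_pub`'s GZK conjunct `rank_eq_analyticRank_of_analyticRank_le_one` returns `Finite W.sha` at analytic rank `≤ 1`. So the supply input
is DISCHARGED, with no new hypothesis:

* §62 `sliceMW_of_fourInputs : S_pub → DoorIndexLawAtTwo → DoorTwistValueAtTwo → S_manin → S_sliceMW` — the glue `stub_doorGlue` VERBATIM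
  (fkl lead g3–g6, `…OneDoorGlue.lean`) except that the door field is taken from this lineage's supply fed with `(hpub.2.1 W _).2`;
* §63 `bsdp_two_bigImageOddLocal_of_fourInputs` — the STATEMENT of crux 23715 `RankOneAtTwoBigImageOddLocal`, spelled out (this helper imports no
  route file), from the four inputs (GZK turns `analyticRank = 1` into rank `1`, as in `…OneDoorAssembly`), and `…_primary` with `S_pub` opened.

What remains displayed: PRINT (`S_pub`: Gross–Zagier, Kolyvagin, GZK, modularity; `S_manin` — theorem at `4 ∤ N`, open at `4 ∣ N`) and the two
CONJECTURES of the lens (`DoorIndexLawAtTwo` = the `2`-part of the Gross–Zagier–BSD index identity at one door; `DoorTwistValueAtTwo` = rank-`0`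
`BSD₂` of the `Sel₂`-trivial twist). BSD is not proved by any of this; crux 23715 is not closed (its closing needs those conjectures).

References: Gross–Zagier 1986 Thm. I.6.3, V.§2; Kolyvagin 1990; Pal 2012 Prop. 2.5, Cor. 2.6; Mazur–Rubin 2010 Prop. 3.3, Cor. 3.4, Prop. 5.2,
Thm. 1.5; Kramer 1981 Prop. 3, 6; Cassels 1962 §1.
-/

set_option linter.dupNamespace false -- tree convention: `Summit.BirchSwinnertonDyer.BirchSwinnertonDyer.Theorems` (summit = sub-problem)
set_option autoImplicit false

noncomputable section

open scoped Classical

namespace Summit.BirchSwinnertonDyer.BirchSwinnertonDyer.Theorems.GenusKolyTransp.OneDoor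

open WeierstrassCurve NumberField IsDedekindDomain Rat.HeightOneSpectrum Literature.NumberTheory.EllipticCurves
  Literature.NumberTheory.EllipticCurves.ModularForms
  Literature.NumberTheory.EllipticCurves.KrizLi2019
  Summit.BirchSwinnertonDyer.Rank1Residual.F1Sign2
  Summit.BirchSwinnertonDyer.Rank1Residual.F1Sign2.TranspositionDoor
  Summit.BirchSwinnertonDyer.Rank1Residual
  Summit.BirchSwinnertonDyer.BirchSwinnertonDyer.Theorems.RankOneAtTwoOneDoor

/-! ## §62 The glue with the supply discharged -/

/-- **`S_sliceMW` FROM FOUR INPUTS** — fkl's `stub_doorGlue` (`S_pub → DoorIndexLawAtTwo → DoorTwistValueAtTwo → DoorSupplyAtTwo → S_manin →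
S_sliceMW`) with the door supply DISCHARGED: the door field `K` comes from this lineage's
`GenusKolyTransp.exists_doorAdmissible_twistSelmerTwoCard_eq_one_of_rank_one_of_shaFinite`, fed with `Finite W.sha` from the GZK conjunct of `S_pub` at
analytic rank `1`; the rest of the proof is fkl's VERBATIM (odd-constant datum, Heegner datum, `K`-rational Heegner point, minimal twist model and
`q_d` from the value law, exponent `m` from the index law, the door `P2.bsdp_two_iff_of_heegner_rankOne`, the `2`-adic bookkeeping).
[cite: GrossZagier1986, Thm. I.6.3 and V.§2] [cite: Pal2012, Prop. 2.5 and Cor. 2.6] [cite: MazurRubin2010, Prop. 3.3, Cor. 3.4 (i), Prop. 5.2, Thm. 1.5] -/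
theorem sliceMW_of_fourInputs (hpub : S_pub) (hIdx : DoorIndexLawAtTwo) (hVal : DoorTwistValueAtTwo) (hMan : S_manin) :
    S_sliceMW := by
  intro W _ _ hCM hsurj hT hc hr hrk
  haveI : Fact (Nat.Prime 2) := ⟨Nat.prime_two⟩
  haveI hN : NeZero (W.conductorNorm ℤ) := ⟨(W.conductorNorm_pos_holds).ne'⟩
  set N : ℕ := W.conductorNorm ℤ with hN_def
  -- `E(ℚ)[2] = 0`
  have hT2 : NoRationalTwoTorsion W := noRationalTwoTorsion_of_odd_torsionOrder W hT
  -- the door field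
  -- the door field: THIS LINEAGE'S `L`-FREE SUPPLY, fed with `Ш(W)` finite from GZK (`S_pub`) at analytic rank `1`
  have hShaFin : W.ShaFinite := (hpub.2.1 W (le_of_eq hr)).2
  obtain ⟨K, _iF, _iN, hK, hadm, hSel, -, hHN⟩ :=
    GenusKolyTransp.exists_doorAdmissible_twistSelmerTwoCard_eq_one_of_rank_one_of_shaFinite W hT2 hrk hShaFin
  have h2 : Module.finrank ℚ K = 2 := hK.1
  haveI : IsTotallyComplex K := hK.2
  -- the odd-constant parametrisation, the Heegner datum, an embedding, the `K`-rational Heegner point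
  obtain ⟨Dt, hcodd⟩ := hMan W hT2
  obtain ⟨H, -⟩ := nonempty_heegnerDatum_holds N K hK (exists_dvd_sq_sub_discr_holds N K hK hHN).choose_spec
  obtain ⟨ι⟩ : Nonempty (K →+* ℂ) := inferInstance
  obtain ⟨hGZ, hKo, hrat⟩ := hpub.1 N W K
  have hGZK : rank_eq_analyticRank_of_analyticRank_le_one := hpub.2.1
  have hmod : hasEntireLFunction_rat := hpub.2.2
  obtain ⟨P, hP⟩ := hrat hK hHN Dt H ι
  -- the minimal twist model and the value law
  have hD0 : (NumberField.discr K : ℚ) ≠ 0 := by exact_mod_cast NumberField.discr_ne_zero K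
  haveI hEt : (W.quadraticTwist (NumberField.discr K : ℚ)).IsElliptic := W.isElliptic_quadraticTwist hD0
  obtain ⟨Cd, hCd⟩ := hasGlobalMinimalModel_rat_holds (W.quadraticTwist (NumberField.discr K : ℚ))
  haveI : (Cd • W.quadraticTwist (NumberField.discr K : ℚ)).IsGloballyMinimal := hCd
  set Wd := Cd • W.quadraticTwist (NumberField.discr K : ℚ) with hWd_def
  have hWd : Cd • W.quadraticTwist (NumberField.discr K : ℚ) = Wd := rfl
  obtain ⟨qd, hqd, hqd0, hvqd⟩ := hVal W hCM hT2 (NumberField.discr K) hadm hSel Wd Cd hWd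
  -- `L(E^{(d_K)}, 1) ≠ 0`
  have hΩdC : (Wd.realPeriodRat : ℂ) ≠ 0 := by exact_mod_cast (Wd.realPeriodRat_pos_holds).ne'
  have hLt : (W.quadraticTwist (NumberField.discr K : ℚ)).entireLFunction 1 ≠ 0 := by
    have hLt' : (W.quadraticTwist (NumberField.discr K : ℚ)).entireLFunction = Wd.entireLFunction := by
      rw [← hWd, entireLFunction_smul]
    rw [hLt']
    intro h0
    apply hqd0
    have : ((qd : ℚ) : ℂ) = 0 := by rw [← hqd, h0, zero_div]
    exact_mod_cast this
  -- the door index law at `(K, Dt, H, ι, P)`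
  obtain ⟨hfin2, m, ⟨Q, hPQ, hQ⟩, hlaw⟩ :=
    hIdx W hCM hsurj hT hc hr K hK hadm hSel hLt Dt H ι P hP hcodd
  -- the door
  have hc0 : Dt.c ≠ 0 := by
    intro h0; apply hcodd; rw [h0]; exact dvd_zero _
  obtain ⟨k, hk12, hkiff, hdoor⟩ :=
    P2.bsdp_two_iff_of_heegner_rankOne W N K Dt H ι P hGZ hKo hGZK hmod hK hHN hP hc0 hr hLt Wd Cd hWd
      qd hqd
  apply hdoor.mpr
  ------------------------------------------------------------------ rank `E(K) = 1`, `Ш(E)` finite (as inside the door)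
  haveI hEK : (W.baseChange K).IsElliptic := isElliptic_baseChange' W K
  have hL0 : W.entireLFunction 1 = 0 := entireLFunction_one_eq_zero_of_analyticRank_eq_one hr
  obtain ⟨-, hderiv⟩ := leadingLCoeff_eq_deriv_of_analyticRank_eq_one hr
  have hprod := lDerivEK_eq_deriv_mul W K hmod hL0
  have hLK : LDerivEK W K ≠ 0 := by rw [hprod]; exact mul_ne_zero hderiv hLt
  have hPH : IsHeegnerPoint N W K P := ⟨Dt, H, ι, hP⟩
  have hPinf : ¬ IsOfFinAddOrder P :=
    (lDerivEK_ne_zero_iff_not_isOfFinAddOrder W N K hGZ hK hHN hPH).mp hLK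
  obtain ⟨hrkK, hShaK⟩ := hKo hK hHN hPH hPinf
  have hShaW : W.ShaFinite := Literature.NumberTheory.EllipticCurves.shaFinite_of_baseChange W K hShaK
  haveI hfinW : Finite W.sha := hShaW
  ------------------------------------------------------------------ `#E(K)_tors` odd, `k = 1`
  have htKodd : Odd (W.baseChange K).torsionOrder := odd_torsionOrder_baseChange_of_noRationalTwoTorsion W hT2 K h2
  have hk1 : k = 1 := by
    rcases hk12 with h | h
    · exact h
    · exact absurd (hkiff.mp h) (P2.not_forall_halvable_of_odd_torsionOrder W K h2 hrkK hrk htKodd)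
  ------------------------------------------------------------------ the index of `P`
  obtain ⟨gK, hgK, hgenK, -, -⟩ :=
    exists_generator_regulator_eq_of_mordellWeilRank_eq_one (W.baseChange K) hrkK
  have hQ' : ¬ ∃ Q' : (W.baseChange K).toAffine.Point,
      Q - 2 • Q' ∈ AddCommGroup.torsion (W.baseChange K).toAffine.Point := hQ
  obtain ⟨hI0, hvIdx⟩ := padicValNat_index_of_twoDivisibility (W.baseChange K) hgK hgenK hPQ hQ'
  have hvtK : padicValNat 2 (W.baseChange K).torsionOrder = 0 :=
    padicValNat.eq_zero_of_not_dvd (fun h => (Nat.not_even_iff_odd.mpr htKodd) (even_iff_two_dvd.mpr h))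
  ------------------------------------------------------------------ `w_K = 2`, `|u| = 1`
  have hw2 : Units.torsionOrder K = 2 :=
    Literature.NumberTheory.QuadraticFields.Quadratic.torsionOrder_eq_two_of_discr_lt_neg_four h2
      (discr_lt_neg_four_of_doorAdmissible hadm)
  have hu1 : |(Cd.u : ℚ)| = 1 := by
    rcases W.u_eq_one_or_eq_neg_one_of_smul_quadraticTwist_of_squarefree (emod_four_of_doorAdmissible hadm)
        hadm.2.1 (good_or_mult_at_dvd_of_doorAdmissible W hadm) Wd Cd hWd with h | h <;> rw [h] <;> simp
  ------------------------------------------------------------------ oddness of `c_W`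
  have hvcWn : padicValNat 2 W.tamagawaProduct = 0 :=
    padicValNat.eq_zero_of_not_dvd (fun h => (Nat.not_even_iff_odd.mpr hc) (even_iff_two_dvd.mpr h))
  ------------------------------------------------------------------ the valuation, factor by factor
  have hΔ0 : W.Δ ≠ 0 := W.isUnit_Δ.ne_zero
  have hI' : ((AddSubgroup.zmultiples P).index : ℚ) ≠ 0 := by exact_mod_cast hI0
  have htW' : (W.torsionOrder : ℚ) ≠ 0 := by exact_mod_cast (W.torsionOrder_pos_holds).ne'
  have htK' : ((W.baseChange K).torsionOrder : ℚ) ≠ 0 := by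
    exact_mod_cast ((W.baseChange K).torsionOrder_pos_holds).ne'
  have hcW' : (W.tamagawaProduct : ℚ) ≠ 0 := by exact_mod_cast (W.tamagawaProduct_pos_holds).ne'
  have hcM : (Dt.c : ℚ) ≠ 0 := by exact_mod_cast hc0
  have hw' : (Units.torsionOrder K : ℚ) ≠ 0 := by rw [hw2]; norm_num
  have hua : |(Cd.u : ℚ)| ≠ 0 := abs_ne_zero.mpr Cd.u.ne_zero
  have hk' : ((k : ℕ) : ℚ) ≠ 0 := by rw [hk1]; norm_num
  have hn12 : (W.baseChange ℝ).numRealComponents = 1 ∨ (W.baseChange ℝ).numRealComponents = 2 :=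
    numRealComponents_eq_one_or W
  have hn' : ((W.baseChange ℝ).numRealComponents : ℚ) ≠ 0 := by
    rcases hn12 with h | h <;> rw [h] <;> norm_num
  -- valuations of the single factors
  have h8 : padicValRat 2 (8 : ℚ) = 3 := by
    rw [show (8 : ℚ) = ((2 : ℕ) : ℚ) ^ 3 by norm_num, padicValRat.pow, padicValRat.self one_lt_two]; norm_num
  have hvI : padicValRat 2 ((AddSubgroup.zmultiples P).index : ℚ) = (m : ℤ) := by
    rw [padicValRat.of_nat, hvIdx, hvtK]; push_cast; ring
  have hvtW : padicValRat 2 (W.torsionOrder : ℚ) = 0 := by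
    rw [padicValRat.of_nat, padicValNat.eq_zero_of_not_dvd
      (fun h => (Nat.not_even_iff_odd.mpr hT) (even_iff_two_dvd.mpr h))]; rfl
  have hvtKq : padicValRat 2 ((W.baseChange K).torsionOrder : ℚ) = 0 := by
    rw [padicValRat.of_nat, hvtK]; rfl
  have hvcW : padicValRat 2 (W.tamagawaProduct : ℚ) = 0 := by
    rw [padicValRat.of_nat, hvcWn]; rfl
  have hvc : padicValRat 2 (Dt.c : ℚ) = 0 := by
    rw [padicValRat.of_int, padicValInt.eq_zero_of_not_dvd hcodd]; rfl
  have hvw : padicValRat 2 (Units.torsionOrder K : ℚ) = 1 := by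
    rw [hw2]; exact padicValRat.self one_lt_two
  have hvu : padicValRat 2 |(Cd.u : ℚ)| = 0 := by rw [hu1]; exact padicValRat.one
  have hvk : padicValRat 2 ((k : ℕ) : ℚ) = 0 := by
    rw [hk1, Nat.cast_one]; exact padicValRat.one
  have hvqd' : padicValRat 2 qd =
      (transpCount W (NumberField.discr K) : ℤ) + 2 * (identCount W (NumberField.discr K) : ℤ) := by
    rw [hvqd, hvcWn]; push_cast; ring
  -- numerator and denominator
  have hA1 : (8 : ℚ) * ((AddSubgroup.zmultiples P).index : ℚ) ^ 2 ≠ 0 :=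
    mul_ne_zero (by norm_num) (pow_ne_zero _ hI')
  have hA2 : (8 : ℚ) * ((AddSubgroup.zmultiples P).index : ℚ) ^ 2 * (W.torsionOrder : ℚ) ^ 2 ≠ 0 :=
    mul_ne_zero hA1 (pow_ne_zero _ htW')
  have hD1 : ((W.baseChange ℝ).numRealComponents : ℚ) * ((k : ℕ) : ℚ) ^ 2 ≠ 0 :=
    mul_ne_zero hn' (pow_ne_zero _ hk')
  have hD2 : ((W.baseChange ℝ).numRealComponents : ℚ) * ((k : ℕ) : ℚ) ^ 2 *
      ((W.baseChange K).torsionOrder : ℚ) ^ 2 ≠ 0 := mul_ne_zero hD1 (pow_ne_zero _ htK')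
  have hD3 : ((W.baseChange ℝ).numRealComponents : ℚ) * ((k : ℕ) : ℚ) ^ 2 *
      ((W.baseChange K).torsionOrder : ℚ) ^ 2 * (Dt.c : ℚ) ^ 2 ≠ 0 := mul_ne_zero hD2 (pow_ne_zero _ hcM)
  have hD4 : ((W.baseChange ℝ).numRealComponents : ℚ) * ((k : ℕ) : ℚ) ^ 2 *
      ((W.baseChange K).torsionOrder : ℚ) ^ 2 * (Dt.c : ℚ) ^ 2 * (Units.torsionOrder K : ℚ) ^ 2 ≠ 0 :=
    mul_ne_zero hD3 (pow_ne_zero _ hw')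
  have hD5 : ((W.baseChange ℝ).numRealComponents : ℚ) * ((k : ℕ) : ℚ) ^ 2 *
      ((W.baseChange K).torsionOrder : ℚ) ^ 2 * (Dt.c : ℚ) ^ 2 * (Units.torsionOrder K : ℚ) ^ 2 * qd ≠ 0 :=
    mul_ne_zero hD4 hqd0
  have hD6 : ((W.baseChange ℝ).numRealComponents : ℚ) * ((k : ℕ) : ℚ) ^ 2 *
      ((W.baseChange K).torsionOrder : ℚ) ^ 2 * (Dt.c : ℚ) ^ 2 * (Units.torsionOrder K : ℚ) ^ 2 * qd *
      |(Cd.u : ℚ)| ≠ 0 := mul_ne_zero hD5 hua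
  have hD7 : ((W.baseChange ℝ).numRealComponents : ℚ) * ((k : ℕ) : ℚ) ^ 2 *
      ((W.baseChange K).torsionOrder : ℚ) ^ 2 * (Dt.c : ℚ) ^ 2 * (Units.torsionOrder K : ℚ) ^ 2 * qd *
      |(Cd.u : ℚ)| * (W.tamagawaProduct : ℚ) ≠ 0 := mul_ne_zero hD6 hcW'
  have hnum : padicValRat 2 ((8 : ℚ) * ((AddSubgroup.zmultiples P).index : ℚ) ^ 2 * (W.torsionOrder : ℚ) ^ 2) =
      3 + 2 * (m : ℤ) := by
    rw [padicValRat.mul hA1 (pow_ne_zero _ htW'), padicValRat.mul (by norm_num) (pow_ne_zero _ hI'),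
      padicValRat.pow, padicValRat.pow, h8, hvI, hvtW]
    ring
  have hden : padicValRat 2 (((W.baseChange ℝ).numRealComponents : ℚ) * ((k : ℕ) : ℚ) ^ 2 *
      ((W.baseChange K).torsionOrder : ℚ) ^ 2 * (Dt.c : ℚ) ^ 2 * (Units.torsionOrder K : ℚ) ^ 2 * qd *
      |(Cd.u : ℚ)| * (W.tamagawaProduct : ℚ)) =
      padicValRat 2 ((W.baseChange ℝ).numRealComponents : ℚ) + 2 +
        ((transpCount W (NumberField.discr K) : ℤ) + 2 * (identCount W (NumberField.discr K) : ℤ)) := by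
    rw [padicValRat.mul hD6 hcW', padicValRat.mul hD5 hua, padicValRat.mul hD4 hqd0,
      padicValRat.mul hD3 (pow_ne_zero _ hw'), padicValRat.mul hD2 (pow_ne_zero _ hcM),
      padicValRat.mul hD1 (pow_ne_zero _ htK'), padicValRat.mul hn' (pow_ne_zero _ hk'),
      padicValRat.pow, padicValRat.pow, padicValRat.pow, padicValRat.pow,
      hvk, hvtKq, hvc, hvw, hvqd', hvu, hvcW]
    ring
  have hprim : padicValNat 2 (Nat.card (AddCommGroup.primaryComponent W.sha 2)) =
      padicValNat 2 (Nat.card W.sha) := padicValNat_card_addPrimaryComponent 2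
  rw [padicValRat.div hA2 hD7, hnum, hden, ← hprim]
  -- the law, by the sign of `Δ`
  rcases lt_or_gt_of_ne hΔ0 with hneg | hpos
  · rw [if_pos hneg] at hlaw
    rw [P2.numRealComponents_eq_one_of_Δ_neg hneg, Nat.cast_one, padicValRat.one]
    have hlawZ : (2 * m + 1 : ℤ) =
        (padicValNat 2 (Nat.card (AddCommGroup.primaryComponent W.sha 2)) : ℤ) +
          transpCount W (NumberField.discr K) + 2 * identCount W (NumberField.discr K) := by
      exact_mod_cast hlaw
    omega
  · rw [if_neg (not_lt.mpr hpos.le), add_zero] at hlaw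
    rw [P2.numRealComponents_eq_two_of_Δ_pos hpos, show ((2 : ℕ) : ℚ) = ((2 : ℕ) : ℚ) from rfl,
      padicValRat.self one_lt_two]
    have hlawZ : (2 * m : ℤ) =
        (padicValNat 2 (Nat.card (AddCommGroup.primaryComponent W.sha 2)) : ℤ) +
          transpCount W (NumberField.discr K) + 2 * identCount W (NumberField.discr K) := by
      exact_mod_cast hlaw
    omega


/-! ## §63 The crux's statement from four inputs (Theses-free spelling) -/

/-- **The statement of crux `RankOneAtTwoBigImageOddLocal` (stmt-23715), spelled out, from FOUR inputs** (`S_pub`, the door index law, the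
twist value law, `S_manin`) — fkl's `rankOneAtTwoBigImageOddLocal_of_oneDoor` with `DoorSupplyAtTwo` discharged (GZK turns `analyticRank = 1` into
Mordell–Weil rank `1`). This file imports no route file, so the conclusion is written out; a seat holding 23715 closes the named decl from it by
`exact`. BSD is not proved: two of the four inputs are conjectures of the lens. [cite: GrossZagier1986, Thm. I.6.3 and V.§2] [cite: Pal2012, Prop. 2.5 and Cor. 2.6] -/
theorem bsdp_two_bigImageOddLocal_of_fourInputs (hpub : S_pub) (hIdx : DoorIndexLawAtTwo) (hVal : DoorTwistValueAtTwo) (hMan : S_manin) :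
    ∀ (W : WeierstrassCurve ℚ) [W.IsElliptic] [W.IsGloballyMinimal], ¬ W.HasCM →
      (∀ n : ℕ, W.HasSurjectiveModNGaloisRep ((2 ^ n : ℕ) : ℤ)) → Odd W.torsionOrder → Odd W.tamagawaProduct →
      W.analyticRank = 1 → BSDp W 2 := by
  intro W _ _ hCM hsurj hT hc hr
  have hrk : W.mordellWeilRank = 1 := by
    have h := (hpub.2.1 W (le_of_eq hr)).1
    rw [h, hr]
  exact sliceMW_of_fourInputs hpub hIdx hVal hMan W hCM hsurj hT hc hr hrk

/-- The same with `S_pub` opened into its named published inputs (Gross–Zagier and Kolyvagin for every level / curve / field, GZK over `ℚ`,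
modularity; the Heegner-rationality conjunct is the tree theorem `heegnerPointComplex_mem_range_map_holds`). -/
theorem bsdp_two_bigImageOddLocal_of_fourInputs_primary
    (hGZ : ∀ (N : ℕ) [NeZero N] (W : WeierstrassCurve ℚ) (K : Type) [Field K] [NumberField K], gross_zagier N W K)
    (hKo : ∀ (N : ℕ) [NeZero N] (W : WeierstrassCurve ℚ) (K : Type) [Field K] [NumberField K], kolyvagin N W K)
    (hGZK : rank_eq_analyticRank_of_analyticRank_le_one) (hmod : WeierstrassCurve.hasEntireLFunction_rat)
    (hIdx : DoorIndexLawAtTwo) (hVal : DoorTwistValueAtTwo) (hMan : S_manin) :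
    ∀ (W : WeierstrassCurve ℚ) [W.IsElliptic] [W.IsGloballyMinimal], ¬ W.HasCM →
      (∀ n : ℕ, W.HasSurjectiveModNGaloisRep ((2 ^ n : ℕ) : ℤ)) → Odd W.torsionOrder → Odd W.tamagawaProduct →
      W.analyticRank = 1 → BSDp W 2 :=
  bsdp_two_bigImageOddLocal_of_fourInputs
    ⟨fun N _ W K _ _ => ⟨hGZ N W K, hKo N W K, heegnerPointComplex_mem_range_map_holds N W K⟩, hGZK, hmod⟩ hIdx hVal hMan

end Summit.BirchSwinnertonDyer.BirchSwinnertonDyer.Theorems.GenusKolyTransp.OneDoor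

end
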